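import Literature.Analysis.SegalBargmann.HermiteOscillator
import Mathlib.RingTheory.MvPolynomial.EulerIdentity
import HarnessLib

/-!
# Creation/annihilation operators on Schwartz space and the Bargmann dictionary for the number operator
(Folland 1989, §1.7 (1.73)–(1.82))

Topic `Analysis/SegalBargmann`; namespace `Literature.Analysis.SegalBargmann`.  Continuation of
`Literature.Analysis.SegalBargmann.HermiteOscillator`.  Folland's **creation and annihilation operators**
`Z_j^* = X_j − iD_j`, `Z_j = X_j + iD_j` (`D_j = (2πi)⁻¹∂_j`, `X_j = x_j`) are realised as continuous linear operators
`zsCLM j`, `zCLM j` on `𝓢(ℝ^σ, ℂ)`, and their action on the Hermite span `hermiteSchwartz p` is identified with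
the symbol calculus of `FockHermite` (`opZs`, `opZ`):

* §1 `zCLM`, `zsCLM`, `zCLM_hermiteSchwartz`, `zsCLM_hermiteSchwartz`; the vacuum `h_0 = hermiteSchwartz (vac σ)`
  is annihilated (`zCLM_vacuum`).
* §2 THE LADDER (Folland (1.82)): `Z_j^* h_α = √((α_j+1)/π) h_{α+1_j}`, `Z_j h_α = √(α_j/π) h_{α−1_j}`, and the
  per-variable number operator `π Z_j^* Z_j h_α = α_j h_α`; on the Hermite span the Hermite operator of
  `HermiteOscillator` is `2π(D_j²+X_j²) = 2π Z_j^* Z_j + 1` (`hermiteOpCLM_eq_ladder_hermiteSchwartz`).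
* §3 THE BARGMANN DICTIONARY on genuine Schwartz functions: with `B⁻¹ F := hermiteSchwartz (binv F)` for a Fock
  polynomial `F ∈ ℂ[z_σ]` (Folland (1.73)–(1.78); `binv` of `FockHermite`),
  `Z_j^* (B⁻¹F) = B⁻¹(z_j F)`, `Z_j (B⁻¹F) = π⁻¹ B⁻¹(∂F/∂z_j)`, hence
  **`π Z_j^* Z_j (B⁻¹F) = B⁻¹(z_j ∂F/∂z_j)`** and **`numberOpCLM (B⁻¹F) = B⁻¹(Σ_j z_j ∂F/∂z_j)`**: the number operator
  of the Schrödinger model IS the Euler (degree) operator of the Fock model; for `F` homogeneous of degree `d`,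
  `numberOpCLM (B⁻¹F) = d · B⁻¹F` (Mathlib's Euler identity `MvPolynomial.IsHomogeneous.sum_X_mul_pderiv`).

Everything is proved from Mathlib and the imported tree files; no cited fact is used as a hypothesis.

Motivation (not used in any statement): §3 is the Lie-algebra-level form of the statement that the Bargmann
transform intertwines the oscillator (compact torus) action of the Schrödinger model with the degree grading of the
Fock model (Folland 1989, Prop. (4.49), §1.7 Thm (1.83)) — the archimedean `K`-type / weight bookkeeping of theta
correspondences is read on the Fock side and realised on the Schwartz side through this dictionary.

## References

* G. B. Folland, *Harmonic Analysis in Phase Space*, Annals of Mathematics Studies 122, Princeton UP (1989): §1.7,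
  (1.73)–(1.78) (Bargmann transform intertwines `z_j`, `∂/∂z_j` with `Z_j^*`, `πZ_j`), (1.80) (commutation
  relations), (1.82) (the ladder), Thm (1.83).  [cite: Folland1989, §1.7]

## Provenance

Written for the tree under the LEAN-IN-TREE rule (2026-08-18) by the pub-hodgecm formalisation cell (model-construction
sub-cell, seat mc-binder-2), over the tree files `FockHermite`, `HermiteSchwartz`, `HermiteOscillator`.
-/

set_option autoImplicit false

noncomputable section

open MvPolynomial Complex SchwartzMap
open scoped BigOperators Real LineDeriv

namespace Literature.Analysis.SegalBargmann

variable {σ : Type*} [Fintype σ] [DecidableEq σ]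

/-! ## §1  `Z_j` and `Z_j^*` on `𝓢(ℝ^σ, ℂ)` -/

section Ladder

/-- **Folland's annihilation operator `Z_j = X_j + iD_j`** on `𝓢(ℝ^σ, ℂ)` (§1.7; `= x_j + (2π)⁻¹∂_j`).
[cite: Folland1989, §1.7] -/
def zCLM (j : σ) : 𝓢(EuclideanSpace ℝ σ, ℂ) →L[ℂ] 𝓢(EuclideanSpace ℝ σ, ℂ) :=
  coordMulCLM j + I • opDCLM j

/-- **Folland's creation operator `Z_j^* = X_j − iD_j`** on `𝓢(ℝ^σ, ℂ)` (§1.7; `= x_j − (2π)⁻¹∂_j`).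
[cite: Folland1989, §1.7] -/
def zsCLM (j : σ) : 𝓢(EuclideanSpace ℝ σ, ℂ) →L[ℂ] 𝓢(EuclideanSpace ℝ σ, ℂ) :=
  coordMulCLM j - I • opDCLM j

/-- **`Z_j` on the Hermite span** has symbol `opZ j = opX j + I • opD j`:
`Z_j (hermiteSchwartz p) = hermiteSchwartz (opZ j p)`. [folklore] -/
theorem zCLM_hermiteSchwartz (j : σ) (p : MvPolynomial σ ℂ) :
    zCLM j (hermiteSchwartz p) = hermiteSchwartz (opZ j p) := by
  have h1 : zCLM j (hermiteSchwartz p) = coordMulCLM j (hermiteSchwartz p) + I • opDCLM j (hermiteSchwartz p) :=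
    rfl
  have h2 : opZ j p = opX j p + I • opD j p := rfl
  rw [h1, h2, coordMulCLM_hermiteSchwartz, opDCLM_hermiteSchwartz, ← hermiteSchwartz_smul, ← hermiteSchwartz_add]

/-- **`Z_j^*` on the Hermite span** has symbol `opZs j = opX j − I • opD j`:
`Z_j^* (hermiteSchwartz p) = hermiteSchwartz (opZs j p)`. [folklore] -/
theorem zsCLM_hermiteSchwartz (j : σ) (p : MvPolynomial σ ℂ) :
    zsCLM j (hermiteSchwartz p) = hermiteSchwartz (opZs j p) := by
  have h1 : zsCLM j (hermiteSchwartz p) = coordMulCLM j (hermiteSchwartz p) - I • opDCLM j (hermiteSchwartz p) :=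
    rfl
  have h2 : opZs j p = opX j p - I • opD j p := rfl
  rw [h1, h2, coordMulCLM_hermiteSchwartz, opDCLM_hermiteSchwartz, ← hermiteSchwartz_smul, sub_eq_add_neg,
    ← neg_one_smul ℂ (hermiteSchwartz (I • opD j p)), ← hermiteSchwartz_smul, ← hermiteSchwartz_add, neg_one_smul,
    ← sub_eq_add_neg]

/-- **The vacuum is annihilated**: `Z_j h_0 = 0` for the Gaussian `h_0 = hermiteSchwartz (vac σ)` (Folland §1.7,
`A_j ζ_0 = 0` transported). [folklore] -/
theorem zCLM_vacuum (j : σ) : zCLM j (hermiteSchwartz (vac σ)) = 0 := by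
  rw [zCLM_hermiteSchwartz, opZ_vac]
  ext x
  rw [hermiteSchwartz_apply]
  simp [hermiteFun]

end Ladder

/-! ## §2  The ladder and the number operator on the Hermite functions -/

section HermiteLadder

/-- **Folland (1.82), creation half, on genuine Schwartz functions**: `Z_j^* h_α = √((α_j+1)/π) · h_{α+1_j}`.
[cite: Folland1989, (1.82)] -/
theorem zsCLM_herm (j : σ) (α : σ →₀ ℕ) :
    zsCLM j (hermiteSchwartz (herm α)) =
      (Real.sqrt ((α j + 1) / π) : ℂ) • hermiteSchwartz (herm (α + Finsupp.single j 1)) := by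
  rw [zsCLM_hermiteSchwartz, opZs_herm, hermiteSchwartz_smul]

/-- **Folland (1.82), annihilation half, on genuine Schwartz functions**: `Z_j h_α = √(α_j/π) · h_{α−1_j}`
(the coefficient vanishes when `α_j = 0`). [cite: Folland1989, (1.82)] -/
theorem zCLM_herm (j : σ) (α : σ →₀ ℕ) :
    zCLM j (hermiteSchwartz (herm α)) =
      (Real.sqrt (α j / π) : ℂ) • hermiteSchwartz (herm (α - Finsupp.single j 1)) := by
  rw [zCLM_hermiteSchwartz, opZ_herm, hermiteSchwartz_smul]

/-- **The per-variable number operator**: `π Z_j^* Z_j h_α = α_j · h_α` (Folland (1.77) `A_j^*A_j ζ_α = α_j ζ_α`,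
transported by (1.78)/(1.81)). [cite: Folland1989, §1.7] -/
theorem zsCLM_zCLM_herm (j : σ) (α : σ →₀ ℕ) :
    (π : ℂ) • zsCLM j (zCLM j (hermiteSchwartz (herm α))) = (α j : ℂ) • hermiteSchwartz (herm α) := by
  rw [zCLM_hermiteSchwartz, zsCLM_hermiteSchwartz, opZs_opZ_herm, hermiteSchwartz_smul, smul_smul,
    mul_comm, mul_assoc, inv_mul_cancel₀ (Complex.ofReal_ne_zero.mpr Real.pi_ne_zero), mul_one]

/-- **`2π(D_j² + X_j²) = 2π Z_j^* Z_j + 1` on the Hermite span** (Folland §1.7 (vi), normally ordered form;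
`HermiteOscillator.hermiteOpCLM` versus the ladder operators). [cite: Folland1989, §1.7] -/
theorem hermiteOpCLM_eq_ladder_hermiteSchwartz (j : σ) (p : MvPolynomial σ ℂ) :
    hermiteOpCLM j (hermiteSchwartz p) =
      (2 * π : ℂ) • zsCLM j (zCLM j (hermiteSchwartz p)) + hermiteSchwartz p := by
  rw [hermiteOpCLM_hermiteSchwartz, hermiteOp_apply, zCLM_hermiteSchwartz, zsCLM_hermiteSchwartz,
    hermiteSchwartz_add, hermiteSchwartz_smul]

end HermiteLadder

/-! ## §3  The Bargmann dictionary on `𝓢(ℝ^σ, ℂ)`: `Z_j^* ↔ z_j`, `πZ_j ↔ ∂/∂z_j`, number operator ↔ Euler operator -/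

section Bargmann

/-- **Dictionary, creation half (Folland (1.73)/(1.75))**: `Z_j^* (B⁻¹ F) = B⁻¹ (z_j F)`, where
`B⁻¹ F := hermiteSchwartz (binv F)` is the inverse Bargmann transform of the Fock polynomial `F`. [cite: Folland1989, §1.7] -/
theorem zsCLM_binv (j : σ) (F : MvPolynomial σ ℂ) :
    zsCLM j (hermiteSchwartz (binv F)) = hermiteSchwartz (binv (X j * F)) := by
  rw [zsCLM_hermiteSchwartz, binv_X_mul]

/-- **Dictionary, annihilation half (Folland (1.73)/(1.74))**: `Z_j (B⁻¹ F) = π⁻¹ B⁻¹ (∂F/∂z_j)`.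
[cite: Folland1989, §1.7] -/
theorem zCLM_binv (j : σ) (F : MvPolynomial σ ℂ) :
    zCLM j (hermiteSchwartz (binv F)) = (π : ℂ)⁻¹ • hermiteSchwartz (binv (pderiv j F)) := by
  rw [zCLM_hermiteSchwartz, opZ_binv, hermiteSchwartz_smul]

/-- **The per-variable number operator is the per-variable Euler operator of the Fock model**:
`π Z_j^* Z_j (B⁻¹ F) = B⁻¹ (z_j ∂F/∂z_j)`. [cite: Folland1989, §1.7] -/
theorem zsCLM_zCLM_binv (j : σ) (F : MvPolynomial σ ℂ) :
    (π : ℂ) • zsCLM j (zCLM j (hermiteSchwartz (binv F))) = hermiteSchwartz (binv (X j * pderiv j F)) := by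
  rw [zCLM_hermiteSchwartz, zsCLM_hermiteSchwartz, opZs_opZ_binv, hermiteSchwartz_smul, smul_smul,
    mul_inv_cancel₀ (Complex.ofReal_ne_zero.mpr Real.pi_ne_zero), one_smul]

/-- On the Hermite span the number operator of `HermiteOscillator` is `Σ_j π Z_j^* Z_j`:
`numberOpCLM (hermiteSchwartz p) = Σ_j π • Z_j^* Z_j (hermiteSchwartz p)`. [folklore] -/
theorem numberOpCLM_hermiteSchwartz_eq_sum (p : MvPolynomial σ ℂ) :
    numberOpCLM (hermiteSchwartz p) = ∑ j : σ, (π : ℂ) • zsCLM j (zCLM j (hermiteSchwartz p)) := by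
  rw [numberOpCLM, smul_apply, sum_apply]
  simp_rw [sub_apply, ContinuousLinearMap.id_apply, hermiteOpCLM_eq_ladder_hermiteSchwartz, add_sub_cancel_right]
  rw [Finset.smul_sum]
  refine Finset.sum_congr rfl fun j _ => ?_
  rw [smul_smul]
  congr 1
  rw [one_div, ← mul_assoc, show ((2 : ℂ)⁻¹ * 2) = 1 by norm_num, one_mul]

/-- **The number operator of the Schrödinger model is the Euler (degree) operator of the Fock model**:
`numberOpCLM (B⁻¹ F) = B⁻¹ (Σ_j z_j ∂F/∂z_j)` for every Fock polynomial `F ∈ ℂ[z_σ]`.  [cite: Folland1989, §1.7] -/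
theorem numberOpCLM_binv (F : MvPolynomial σ ℂ) :
    numberOpCLM (hermiteSchwartz (binv F)) = hermiteSchwartz (binv (∑ j : σ, X j * pderiv j F)) := by
  rw [numberOpCLM_hermiteSchwartz_eq_sum]
  simp_rw [zsCLM_zCLM_binv]
  rw [map_sum]
  exact (map_sum (hermiteSchwartzₗ (σ := σ)) (fun j => binv (X j * pderiv j F)) Finset.univ).symm

/-- **Euler's identity transported**: for a Fock polynomial `F` homogeneous of degree `d`,
`numberOpCLM (B⁻¹ F) = d · B⁻¹ F` — the degree-`d` Fock space `𝒫_d` is carried by the (inverse) Bargmann transform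
into the `d`-eigenspace of the number operator (Folland §1.7 with Mathlib's Euler identity
`MvPolynomial.IsHomogeneous.sum_X_mul_pderiv`). [cite: Folland1989, §1.7] -/
theorem numberOpCLM_binv_of_isHomogeneous {F : MvPolynomial σ ℂ} {d : ℕ} (hF : F.IsHomogeneous d) :
    numberOpCLM (hermiteSchwartz (binv F)) = (d : ℂ) • hermiteSchwartz (binv F) := by
  rw [numberOpCLM_binv, hF.sum_X_mul_pderiv, map_nsmul, ← Nat.cast_smul_eq_nsmul ℂ, hermiteSchwartz_smul]

end Bargmann

end Literature.Analysis.SegalBargmann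

end
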